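import Literature.MathematicalPhysics.QuantumFieldTheory.Balaban1983to89.T4StabilityFloor
import Literature.MathematicalPhysics.QuantumFieldTheory.Balaban1983to89.B16ZLower

/-!
# Bałaban's 4-d lattice Yang–Mills on the finite torus `T⁴` — the (γ) floor of the stability socket IN THE CONCRETE
MODELS `G = SU(N)`, `U(N)` (`T4StabilityFloorUnitary`): the two model facts discharged by name, the floor a closed-form number

HONEST FRAMING (page 1, binding).  Rung (B)+1 on the FINITE torus only — NOT infinite volume, NOT a mass gap, NOT the
Clay problem; nothing here is summit progress.  `BetaPertH` / (B) / (B^μ) are hidden in NO definition of this module: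
(B) enters ONLY through the displayed binders `(hcor : B16.Cor3With D.C γB em ep)` / `(hB : B16.EndStatementBPrinted D.C)`
exactly as in `T4StabilitySocket` / `T4StabilityFloor`, `BetaPertH` only through `FiniteEpsData.Tuned`.  Nothing printed by
Bałaban is asserted: every printed-type input is a displayed, NAMED binder (the model dictionary (D1)/(D2)/(D3′) below);
what is PROVED is compact-group arithmetic ALREADY IN THE TREE (`MatrixNorms`, `B16ZLower`,
`Literature.Barriers.QuantumFields.UnitaryHaarSmallBall`), composed by name.  Audit cell `pub-balaban`, node U5c (spine
estimate NE7b in (GD) currency; RULING R-U5c-GD, docket question (v) «is c_low printed-type?»), prover seat P2 (technique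
«renewal process»), unit `b2b-balaban-t4-ne7b-p2-g10`; census item v24b of record `t4/T4-EST-NE7b-P2.md` (v1.1 §4: item
v24c; v1.2 §5: unit `b2b-balaban-t4-ne7b-p2-g11`, self-row T4-U5c.E-NE7b-PROVE-P2k*, item v24d); value = the explicit floor
in the groups the papers mean, NOT an estimate of Bałaban's.

CITATION HEADER (lean-in-tree rule 2026-08-18).  LOCATION tags only; no quotation is a hypothesis beyond the displayed
binders.  [Balaban1985Averaging] T. Bałaban, *Averaging operations for lattice gauge theories*, Commun. Math. Phys. **98**,
17–51 (1985): (19) p.21 (the invariant metric `|U − 1|` in the OPERATOR norm on `G ⊂ U(N)`) — realised by the tree's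
`UnitaryModel` (`dist1 V = ‖V − 1‖_{L²-op}`, `reTr V = Re Tr V / N`; `B16ZLower.dist1_specialUnitaryGroup` /
`reTr_specialUnitaryGroup` are `rfl`).  [Balaban1987RG1] Commun. Math. Phys. **109**, 249–301 (1987): (0.2) p.252 (Wilson
action with the normalised trace; tree `Setup.wilsonAction4`), (0.14) p.254 (its operator-norm half `2[1 − Re tr U] ≤ |U − 1|²`
is the tree's `MatrixNorms.two_mul_one_sub_nReTr_le_opDist1_sq`).  [Balaban1985Variational] Commun. Math. Phys. **102**,
277–309 (1985): Thm 1 p.279 with (8) and (2) p.278 — the TYPE of the binder `hreg`, and «Minimal configurations will be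
denoted by U_k(V), or U_k.» (p.279) — the data binder `uK`; exactly as at `T4StabilityFloor.pointwise_of_reading`; (7) p.278
— displayed as the HYPOTHESIS of `hreg` / `hregLoc` in §5 (v1.2) and discharged on the bond ball by interface arithmetic.
[Balaban1988Convergent] Commun. Math. Phys. **119**, 243–285 (1988): (2.17) p.257 — TYPE of `hchi`; Cor. 3 (2.50) p.264 —
TYPE of `hcor` (by name, `B16.Cor3With`).  Compact groups: [BrockerTomDieck1985] I (5.12) (normalised invariant integral)
through `UnitaryModel.HaarData.ofCompactGroup`; the N-uniform small-ball bounds `Haar_{U(N)}{‖V − 1‖ ≤ ρ} ≥ (ρ/(2π+ρ))^{N²}`,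
`Haar_{SU(N)}{‖V − 1‖ ≤ r} ≥ (4π/((2N+1)r))·(r/(16π+r))^{N²}` are the tree's `haar_unitaryOpBall_ge` (module
`Literature.Barriers.QuantumFields.UnitaryHaarSmallBall`) / `B16ZLower.haarReal_suOpBall_ge` — covering arguments proved
from Mathlib, [folklore].

WHAT THIS MODULE DOES.  `T4StabilityFloor.lowEnvelope_of_cor3With_reading` discharged the (γ) floor of the socket to
product-Haar arithmetic, leaving as displayed binders — besides the model DICTIONARY — two MODEL facts over the abstract
interfaces `GaugeGroup` / `HaarData`: (M1) `0 < haar(B)` for the chosen one-bond set `B`, (M2) `∀ h, 1 − Re tr h ≤ c_G|h − 1|²`,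
plus the measurability of `B` and the plaquette budget `hcount`.  In the cell's concrete models
(`UnitaryModel.instGaugeGroupSpecialUnitaryGroup` / `instHaarDataSpecialUnitaryGroup`, resp. the `U(N)` instances) all four
are THEOREMS OF THE TREE; this leaf composes them BY NAME and fixes the fine lattice to the model's plaquettes:
* §1 — (M2) `one_sub_reTr_le_half_dist1_sq_specialUnitary` / `_unitary`: `1 − reTr V ≤ ½·dist1 V²` on ALL of `SU(N)` /
  `U(N)` (`c_G = ½`); (M1) `haarReal_suOpBall_pos` / `haarReal_unitaryOpBall_pos`: the closed operator-norm balls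
  `B16ZLower.suOpBall N τ` / `unitaryOpBall N τ`, `τ > 0`, have Haar mass `≥` an explicit positive number
  (`suOpBallMass`, `unitaryOpBallMass`); `mem_suOpBall_iff_dist1` / `mem_unitaryOpBall_iff_dist1` (the ball IS `{dist1 ≤ τ}`);
  `wilsonAction4_eq_sum` (`wilsonAction4 U = Σ_p (1 − reTr U(∂p))`).
* §2 — THE FLOOR IN `SU(N)` WITH THE DICTIONARY IN MINIMISER FORM, `lowEnvelope_of_cor3With_minimiser_specialUnitary`: the
  binder list of `T4StabilityFloor.lowEnvelope_of_cor3With_reading` with `G := SU(N)`, `Bset := suOpBall N τ`, `c_G := ½`,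
  `Fine K := Plaq (F.P (κ K)) 0` (the plaquettes of `T_η`), `η K := (F.P (κ K)).eta (κ K)`, `n₄ := 6(2L^m)^4`
  (`T4StabilityFloor.card_plaq_fine_mul_eta_pow`, with EQUALITY) and the plaquette variables `plaq K V p := (uK K V)(∂p)`
  (`GaugeField.plaqHol`) of ONE displayed DATA binder `uK K : GaugeField (F.P (κ K)) (κ K) G → GaugeField (F.P (κ K)) 0 G` —
  the minimiser map `V ↦ U_K(V)` of [Balaban1985Variational] Thm 1, SUPPLIED BY THE INSTANTIATING SEAT, never constructed
  here.  What remains displayed is exactly the dictionary: (D1) `hchi : PlaqSmall (ε_K·η_K²) (uK K V) → χ_K(cfg⁻¹ V) = 1`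
  [(2.17)-TYPE; print's (2.17) localises through the U_{k,□} of (2.16) — the seat reading it chooses the family, see
  `T4StabilityFloor` §5], (D2) `hwil : wilsonBG (cfg⁻¹ V) = wilsonAction4 (uK K V)` [(0.2)/(5)-TYPE, d = 4],
  (D3′) `hreg : (∀ b, V b ∈ suOpBall N τ) → PlaqSmall (B₃ε₁·η_K²) (uK K V)` [Thm 1 (8) + (2) at j = k TYPE; its hypothesis (7)
  with `ε₁ = 4τ` from the bond ball is `T4ExpWindowSmallField` §1's bookkeeping, folded into the binder], `hε : B₃ε₁ ≤ ε_K`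
  — and the socket's own binders (`hsign`, `hcor`, `hγ`, `htuned`, `κ`, `hobs`, `hbd`, (α) `hα`, `hsites`, `hnup`).
  Conclusion: the socket's `LowEnvelope` in its own shapes `nlowOf` / `constOf` with
  `c₀ = floorOf g (½(B₃ε₁)²·6(2L^m)^4) (haar(suOpBall N τ)^{unitBondCount F})`.  Pin form
  `lowEnvelope_of_endStatementBPrinted_minimiser_specialUnitary` (quantifier order of `ForSmallCouplings`); `U(N)` form
  `lowEnvelope_of_cor3With_minimiser_unitary`; and `globalDom_of_minimiser_specialUnitary` (with the numerator fields, (GD)).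
* §3 — THE FLOOR IS A NUMBER: `floorOf_suOpBall_ge` / `floorOf_unitaryOpBall_ge`,
  `c₀ ≥ exp[−a/g²]·((4π/((2N+1)τ))·(τ/(16π+τ))^{N²})^{4(2L^m)^4}` (resp. `((τ/(2π+τ))^{N²})^{4(2L^m)^4}`): a closed form in
  `(g, N, L, m, τ, a)` — no abstract quantity of the node, of the interfaces or of the realisation is left in the bound.
* §4 (v1.1, APPEND-ONLY; item O-R13 of the U5 referee's RULING R-GD-2, `t4/T4-REF-U5.md` §16) — TWO DATA BINDERS.  In
  print (D1) concerns the LOCALISED minimal configurations `U_{K,□}` of [Balaban1988Convergent] (2.16) p. 257 ((2.17) takes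
  `sup_{p⊂□~}` of THEIR plaquette variables), while (D2) ((5)/(2.50)'s `A(U_K(V))`) and (D3′) (Thm 1 (8)) concern the GLOBAL
  minimiser `U_K` — so the one binder `uK` of §2 cannot discharge (D1) and (D2) verbatim AT ONCE (value unaffected; it
  reads (2.17) with the global family, cf. `T4StabilityFloor` §5/§6).  `lowEnvelope_of_cor3With_minimiser₂_specialUnitary`
  (+ `globalDom_of_minimiser₂_specialUnitary`, `lowEnvelope_of_cor3With_minimiser₂_unitary`, and the consistency
  `…_minimiser₂_specialUnitary_self`) = `T4StabilityFloor.lowEnvelope_of_cor3With_reading₂` (v1.1 §6) in the model, with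
  TWO displayed data binders: `uK` (GLOBAL: (D2) `hwil`, (D3′) `hreg`) and `uLoc K V □ : GaugeField (F.P (κ K)) 0 G` for
  `□ : Box K` with the neighbourhood plaquette sets `nbhd K □ : Set (Plaq _ 0)` (LOCALISED: (D1)
  `hchi : (∀ □, ∀ p ∈ nbhd K □, dist1 ((uLoc K V □)(∂p)) < ε_Kη_K²) → χ_K(cfg⁻¹ V) = 1` — (2.17)'s shape «Π_□ χ({sup_{p⊂□~} …})»;
  (D3″) `hregLoc` = (8)-TYPE regularity of the `U_{K,□}` on the bond ball, whose print sentence is to be LOCATED by the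
  dictionary seat or booked [R], R-GD-2 P-6).  SAME floor as §2; §§1–3 byte-identical to v1 (p190948).
* §5 (v1.2, APPEND-ONLY; record `t4/T4-EST-NE7b-P2.md` §5 v3.2 menu item (3)) — HYPOTHESIS (7) DISPLAYED AND DISCHARGED
  ON THE BOND BALL.  `dist1_plaqHol_le_four_mul` (all `|V(b) − 1| ≤ τ` ⟹ all `|V(∂p) − 1| ≤ 4τ`, from `dist1_mul_le` /
  `dist1_inv` alone; the case `U₀ = 1` of the tree's `T4ExpWindowSmallField.plaqSmall_of_bdev_le`, cited by name, NOT
  imported), `plaqSmall_of_bond_le`, `plaqSmall_of_mem_suOpBall` / `plaqSmall_of_mem_unitaryOpBall` (bond ball and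
  `4τ < ε₁` ⟹ `PlaqSmall ε₁ V` = (7) p.278 for `V` on all of `T₁^{(K)}`); and the §4 theorems RE-TYPED with
  (D3′) `hreg : PlaqSmall ε₁ V → PlaqSmall (B₃ε₁η_K²) (uK K V)` (the “(7) ⟹ (8)” shape of [Balaban1985Variational] Thm 1
  for the global minimiser) and (D3″) `hregLoc : PlaqSmall ε₁ V → ∀ □, ∀ p ∈ nbhd K □, |U_{K,□}(V)(∂p) − 1| < B₃ε₁η_K²`
  ((8)-TYPE for the localised minimisers GIVEN (7) for `V`; print route and the located step [R] in the §5 docstring),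
  plus the order binder `h4τ : 4τ < ε₁`: `lowEnvelope_of_cor3With_thm1_specialUnitary`, `globalDom_of_thm1_specialUnitary`,
  `lowEnvelope_of_cor3With_thm1_unitary` (each = the §4 theorem ∘ `plaqSmall_of_mem_…OpBall`, SAME floor), and the
  consistency `hreg_bondBall_of_thm1` (§5's binders give §4's).  §§1–4 byte-identical to v1.1 (p191066).

DOCKET (v) / O-R10 (iii) AFTER THIS LEAF.  On the DENOMINATOR side of (GD) at node U5c nothing is owed as a VALUE or as a
model fact: what is owed is the DICTIONARY ALONE — the data `uK` and the identifications (D1)/(D2)/(D3′), plus the threshold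
order `hε` (one inequality `B₃ε₁ ≤ ε_K = g·p₀(g)` between the instantiation's numbers; with §5's typing also `h4τ : 4τ < ε₁`) — READINGS of the concrete realisation
(`T4ConcreteRealisation` owners / the U5.E instantiator), displayed here as binders, asserted nowhere; (α), the numerator
side (G3)/(G4) and the walls G-ne7bp1-1 / G-ne7bp2-1 are untouched.  (2.50)-lower keeps the grade the socket records
(printed-ASSERTED, d = 4 derivation not in print, G-adv3-2; hypothesis-grade; NEVER `UVBound01`).  The floor is NOT
volume-uniform (`θ^{4(2L^m)^4}`, `a ∝ 6(2L^m)^4`) and (GD) never needed it to be (record v2.7, «at FIXED volume»).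
NOT an estimate of Bałaban's; NOT summit progress.
-/

open MeasureTheory
open scoped BigOperators Matrix

universe u

namespace Literature.MathematicalPhysics.QuantumFieldTheory.Balaban1983to89.T4StabilityFloorUnitary

open Missing T4Continuum T4WeightBudget T4GlobalDenominator T4LiveClassFibration T4StabilitySocket T4StabilityFloor
open UnitaryModel MatrixNorms B16ZLower Literature.Barriers.QuantumFields

/-! ## §1 The two model facts (M1), (M2) in `SU(N)` and `U(N)` — theorems of the tree, by name -/

section ModelFacts

variable {N : ℕ} [NeZero N]

/-- (M2) in `SU(N)`: `1 − Re tr V ≤ ½·|V − 1|²` for EVERY `V ∈ SU(N)` — the operator-norm half of [Balaban1987RG1] (0.14),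
i.e. the tree's `MatrixNorms.two_mul_one_sub_nReTr_le_opDist1_sq` read through the `rfl` dictionary
`B16ZLower.dist1_specialUnitaryGroup` / `reTr_specialUnitaryGroup`.  So `c_G = ½`. [folklore] -/
theorem one_sub_reTr_le_half_dist1_sq_specialUnitary (V : Matrix.specialUnitaryGroup (Fin N) ℂ) :
    1 - reTr V ≤ 1 / 2 * dist1 V ^ 2 := by
  have h := two_mul_one_sub_nReTr_le_opDist1_sq (n := Fin N) (Matrix.specialUnitaryGroup_le_unitaryGroup V.2)
  have hd : dist1 V = opDist1 (V : Matrix (Fin N) (Fin N) ℂ) := rfl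
  rw [reTr_specialUnitaryGroup, hd]
  linarith

/-- (M2) in `U(N)`: `1 − Re tr V ≤ ½·|V − 1|²` for every `V ∈ U(N)`. [folklore] -/
theorem one_sub_reTr_le_half_dist1_sq_unitary (V : Matrix.unitaryGroup (Fin N) ℂ) :
    1 - reTr V ≤ 1 / 2 * dist1 V ^ 2 := by
  have h := two_mul_one_sub_nReTr_le_opDist1_sq (n := Fin N) V.2
  have hd : dist1 V = opDist1 (V : Matrix (Fin N) (Fin N) ℂ) := rfl
  rw [reTr_unitaryGroup, hd]
  linarith

/-- The `SU(N)` operator-norm ball of `B16ZLower` IS the `dist1`-ball `{V | |V − 1| ≤ τ}` of the interface. [folklore] -/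
theorem mem_suOpBall_iff_dist1 {τ : ℝ} {V : Matrix.specialUnitaryGroup (Fin N) ℂ} :
    V ∈ suOpBall N τ ↔ dist1 V ≤ τ := Iff.rfl

/-- The `U(N)` operator-norm ball of `UnitaryHaarSmallBall` IS the `dist1`-ball of the interface. [folklore] -/
theorem mem_unitaryOpBall_iff_dist1 {τ : ℝ} {V : Matrix.unitaryGroup (Fin N) ℂ} :
    V ∈ unitaryOpBall N τ ↔ dist1 V ≤ τ := Iff.rfl

/-- The explicit `SU(N)` small-ball mass `(4π/((2N+1)τ))·(τ/(16π+τ))^{N²}` of `B16ZLower.haarReal_suOpBall_ge`. [folklore] -/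
noncomputable def suOpBallMass (N : ℕ) (τ : ℝ) : ℝ :=
  4 * Real.pi / ((2 * N + 1) * τ) * (τ / (16 * Real.pi + τ)) ^ (N * N)

/-- The explicit `U(N)` small-ball mass `(τ/(2π+τ))^{N²}` of `haar_unitaryOpBall_ge`. [folklore] -/
noncomputable def unitaryOpBallMass (N : ℕ) (τ : ℝ) : ℝ := (τ / (2 * Real.pi + τ)) ^ (N * N)

omit [NeZero N] in
/-- `suOpBallMass N τ > 0` for `τ > 0`. [folklore] -/
theorem suOpBallMass_pos {τ : ℝ} (hτ : 0 < τ) : 0 < suOpBallMass N τ := by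
  unfold suOpBallMass; positivity

omit [NeZero N] in
/-- `unitaryOpBallMass N τ > 0` for `τ > 0`. [folklore] -/
theorem unitaryOpBallMass_pos {τ : ℝ} (hτ : 0 < τ) : 0 < unitaryOpBallMass N τ := by
  unfold unitaryOpBallMass; positivity

/-- (M1) in `SU(N)`, quantitatively: `suOpBallMass N τ ≤ haar(suOpBall N τ)` (`B16ZLower.haarReal_suOpBall_ge`). [folklore] -/
theorem suOpBallMass_le_haarReal {τ : ℝ} (hτ : 0 < τ) :
    suOpBallMass N τ ≤
      (HaarData.haar : Measure (Matrix.specialUnitaryGroup (Fin N) ℂ)).real (suOpBall N τ) :=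
  haarReal_suOpBall_ge hτ

/-- (M1) in `U(N)`, quantitatively: `unitaryOpBallMass N τ ≤ haar(unitaryOpBall N τ)` (`B16ZLower.haarReal_unitaryOpBall_ge`).
[folklore] -/
theorem unitaryOpBallMass_le_haarReal {τ : ℝ} (hτ : 0 < τ) :
    unitaryOpBallMass N τ ≤ (HaarData.haar : Measure (Matrix.unitaryGroup (Fin N) ℂ)).real (unitaryOpBall N τ) :=
  haarReal_unitaryOpBall_ge hτ

/-- (M1) in `SU(N)`: the ball has positive Haar mass. [folklore] -/
theorem haarReal_suOpBall_pos {τ : ℝ} (hτ : 0 < τ) :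
    0 < (HaarData.haar : Measure (Matrix.specialUnitaryGroup (Fin N) ℂ)).real (suOpBall N τ) :=
  (suOpBallMass_pos hτ).trans_le (suOpBallMass_le_haarReal hτ)

/-- (M1) in `U(N)`: the ball has positive Haar mass. [folklore] -/
theorem haarReal_unitaryOpBall_pos {τ : ℝ} (hτ : 0 < τ) :
    0 < (HaarData.haar : Measure (Matrix.unitaryGroup (Fin N) ℂ)).real (unitaryOpBall N τ) :=
  (unitaryOpBallMass_pos hτ).trans_le (unitaryOpBallMass_le_haarReal hτ)

end ModelFacts

/-- The `d = 4` Wilson action of `Setup` as the plain plaquette sum `Σ_p (1 − Re tr U(∂p))` (the shape of the binder `hwil`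
of `T4StabilityFloor.pointwise_of_reading`). [cite: Balaban1987RG1, (0.2) p.252] -/
theorem wilsonAction4_eq_sum {P : Params} {j : ℕ} {G : Type*} [GaugeGroup G] (U : GaugeField P j G) :
    wilsonAction4 U = ∑ p, (1 - reTr (GaugeField.plaqHol U p)) := by
  simp [wilsonAction4, wilsonAction]

/-! ## §2 The floor in `SU(N)` / `U(N)`, dictionary in minimiser form -/

section SpecialUnitary

variable {N : ℕ} [NeZero N] {F : T4Family}

/-- **THE (γ) FLOOR IN `SU(N)`, DICTIONARY IN MINIMISER FORM.**  `T4StabilityFloor.lowEnvelope_of_cor3With_reading` with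
`G := SU(N)`, the one-bond set `B := suOpBall N τ` (measurable, Haar mass `> 0`: (M1) DISCHARGED), `c_G := ½` ((M2)
DISCHARGED), the fine lattice `Fine K := Plaq (F.P (κ K)) 0` with `η K := (F.P (κ K)).eta (κ K)` and `n₄ := 6(2L^m)^4`
(`hcount` DISCHARGED with equality by `card_plaq_fine_mul_eta_pow`), and the plaquette variables of the displayed DATA
`uK K V` («U_K(V)», [Balaban1985Variational] p.279).  Displayed and NOT asserted: the dictionary (D1) `hchi`, (D2) `hwil`,
(D3′) `hreg`, the order `hε`, and the socket's binders.  [cite: Balaban1988Convergent, Cor. 3 (2.50) p.264] -/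
theorem lowEnvelope_of_cor3With_minimiser_specialUnitary
    (D : FiniteEpsData F (Matrix.specialUnitaryGroup (Fin N) ℂ)) (hsign : B16.SignConventions D.C)
    {γB γ g : ℝ} {em ep : ℝ → ℝ} {g₀ : ℕ → ℝ} (hcor : B16.Cor3With D.C γB em ep) (hγ : γ ≤ γB)
    (htuned : D.Tuned γ g g₀) (κ : ℕ → ℕ)
    {obs : (K : ℕ) → GaugeField (F.P K) 0 (Matrix.specialUnitaryGroup (Fin N) ℂ) → ℝ} {B l₀ : ℝ}
    (hobs : ∀ K, Measurable (obs K)) (hbd : ∀ K U, |obs K U| ≤ B)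
    {ι : Type*} {T : ℕ → Finset ι} {A : ℕ → ℝ → ι → ℝ} {K₀ : ℕ}
    (hα : ∀ K t, |t| ≤ l₀ → K₀ ≤ K →
      ∫ U, Real.exp (t * obs (κ K) U) * D.dens (κ K) (g₀ (κ K)) 0 U
          ∂fieldMeasure (F.P (κ K)) 0 (Matrix.specialUnitaryGroup (Fin N) ℂ) ≤ ∑ τ ∈ T K, A K t τ)
    {τ : ℝ} (hτ : 0 < τ)
    (uK : (K : ℕ) → GaugeField (F.P (κ K)) (κ K) (Matrix.specialUnitaryGroup (Fin N) ℂ) →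
      GaugeField (F.P (κ K)) 0 (Matrix.specialUnitaryGroup (Fin N) ℂ))
    {εK : ℕ → ℝ} {B₃ ε₁ n₁ : ℝ}
    (hchi : ∀ K, K₀ ≤ K → ∀ V, PlaqSmall (εK K * (F.P (κ K)).eta (κ K) ^ 2) (uK K V) →
      (D.C ⟨κ K, F.m, g₀ (κ K)⟩).χ (κ K) ((D.real.cfg (κ K) (g₀ (κ K)) (κ K)).symm V) = 1)
    (hwil : ∀ K, K₀ ≤ K → ∀ V,
      (D.C ⟨κ K, F.m, g₀ (κ K)⟩).wilsonBG (κ K) ((D.real.cfg (κ K) (g₀ (κ K)) (κ K)).symm V) = wilsonAction4 (uK K V))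
    (hreg : ∀ K, K₀ ≤ K → ∀ V : GaugeField (F.P (κ K)) (κ K) (Matrix.specialUnitaryGroup (Fin N) ℂ),
      (∀ b, V b ∈ suOpBall N τ) → PlaqSmall (B₃ * ε₁ * (F.P (κ K)).eta (κ K) ^ 2) (uK K V))
    (hε : ∀ K, K₀ ≤ K → B₃ * ε₁ ≤ εK K)
    (hsites : ∀ K, K₀ ≤ K → ((D.C ⟨κ K, F.m, g₀ (κ K)⟩).numSites (κ K) : ℝ) ≤ n₁)
    {nup : ℕ → ℝ → ℝ} {Nup : ℝ} (hnup : ∀ K t, |t| ≤ l₀ → K₀ ≤ K → 0 ≤ nup K t ∧ nup K t ≤ Nup) :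
    LowEnvelope l₀ T A
      (nlowOf l₀ B (max (em g) 0) n₁
        (floorOf g (1 / 2 * (B₃ * ε₁) ^ 2 * (6 * (2 * (F.L : ℝ) ^ F.m) ^ 4))
          ((HaarData.haar : Measure (Matrix.specialUnitaryGroup (Fin N) ℂ)).real (suOpBall N τ) ^ unitBondCount F))) nup
      (constOf l₀ B (max (em g) 0) n₁
        (floorOf g (1 / 2 * (B₃ * ε₁) ^ 2 * (6 * (2 * (F.L : ℝ) ^ F.m) ^ 4))
          ((HaarData.haar : Measure (Matrix.specialUnitaryGroup (Fin N) ℂ)).real (suOpBall N τ) ^ unitBondCount F)) Nup)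
      K₀ :=
  lowEnvelope_of_cor3With_reading D hsign hcor hγ htuned κ hobs hbd hα (measurableSet_suOpBall τ)
    (haarReal_suOpBall_pos hτ) (Fine := fun K => Plaq (F.P (κ K)) 0) (fun K V p => GaugeField.plaqHol (uK K V) p)
    (εK := εK) (η := fun K => (F.P (κ K)).eta (κ K))
    (fun K hK V hV => hchi K hK V hV) (fun K hK V => by rw [hwil K hK V, wilsonAction4_eq_sum])
    one_sub_reTr_le_half_dist1_sq_specialUnitary (by norm_num)
    (fun K _ => (card_plaq_fine_mul_eta_pow F (κ K)).le) (fun K hK V hV => hreg K hK V hV) hε hsites hnup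

/-- **… FROM THE PIN** `(hB : B16.EndStatementBPrinted D.C)`, in the quantifier order of the cell's conditional targets
(`ForSmallCouplings`): `∃ γ₀ > 0, ∀ γ ≤ γ₀, ∀ g, ∃ Em ≥ 0, ∀ g₀ tuned, …`.  The `Thm1Printed` conjunct of the pin is not used.
[cite: Balaban1988Convergent, Cor. 3 (2.50) p.264] -/
theorem lowEnvelope_of_endStatementBPrinted_minimiser_specialUnitary
    (D : FiniteEpsData F (Matrix.specialUnitaryGroup (Fin N) ℂ)) (hsign : B16.SignConventions D.C)
    (hB : B16.EndStatementBPrinted D.C)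
    (obs : (K : ℕ) → GaugeField (F.P K) 0 (Matrix.specialUnitaryGroup (Fin N) ℂ) → ℝ) (B l₀ : ℝ)
    (hobs : ∀ K, Measurable (obs K)) (hbd : ∀ K U, |obs K U| ≤ B) :
    ∃ γ₀ : ℝ, 0 < γ₀ ∧ ∀ γ g : ℝ, γ ≤ γ₀ → ∃ Em : ℝ, 0 ≤ Em ∧
      ∀ (g₀ : ℕ → ℝ), D.Tuned γ g g₀ → ∀ (κ : ℕ → ℕ) {ι : Type u} (T : ℕ → Finset ι) (A : ℕ → ℝ → ι → ℝ) (K₀ : ℕ),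
        (∀ K t, |t| ≤ l₀ → K₀ ≤ K →
          ∫ U, Real.exp (t * obs (κ K) U) * D.dens (κ K) (g₀ (κ K)) 0 U
              ∂fieldMeasure (F.P (κ K)) 0 (Matrix.specialUnitaryGroup (Fin N) ℂ) ≤ ∑ τ ∈ T K, A K t τ) →
        ∀ (τ : ℝ), 0 < τ →
        ∀ (uK : (K : ℕ) → GaugeField (F.P (κ K)) (κ K) (Matrix.specialUnitaryGroup (Fin N) ℂ) →
            GaugeField (F.P (κ K)) 0 (Matrix.specialUnitaryGroup (Fin N) ℂ)) (εK : ℕ → ℝ) (B₃ ε₁ n₁ : ℝ),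
          (∀ K, K₀ ≤ K → ∀ V, PlaqSmall (εK K * (F.P (κ K)).eta (κ K) ^ 2) (uK K V) →
            (D.C ⟨κ K, F.m, g₀ (κ K)⟩).χ (κ K) ((D.real.cfg (κ K) (g₀ (κ K)) (κ K)).symm V) = 1) →
          (∀ K, K₀ ≤ K → ∀ V,
            (D.C ⟨κ K, F.m, g₀ (κ K)⟩).wilsonBG (κ K) ((D.real.cfg (κ K) (g₀ (κ K)) (κ K)).symm V) =
              wilsonAction4 (uK K V)) →
          (∀ K, K₀ ≤ K → ∀ V : GaugeField (F.P (κ K)) (κ K) (Matrix.specialUnitaryGroup (Fin N) ℂ),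
            (∀ b, V b ∈ suOpBall N τ) → PlaqSmall (B₃ * ε₁ * (F.P (κ K)).eta (κ K) ^ 2) (uK K V)) →
          (∀ K, K₀ ≤ K → B₃ * ε₁ ≤ εK K) →
          (∀ K, K₀ ≤ K → ((D.C ⟨κ K, F.m, g₀ (κ K)⟩).numSites (κ K) : ℝ) ≤ n₁) →
        ∀ (nup : ℕ → ℝ → ℝ) (Nup : ℝ), (∀ K t, |t| ≤ l₀ → K₀ ≤ K → 0 ≤ nup K t ∧ nup K t ≤ Nup) →
          LowEnvelope l₀ T A
            (nlowOf l₀ B Em n₁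
              (floorOf g (1 / 2 * (B₃ * ε₁) ^ 2 * (6 * (2 * (F.L : ℝ) ^ F.m) ^ 4))
                ((HaarData.haar : Measure (Matrix.specialUnitaryGroup (Fin N) ℂ)).real (suOpBall N τ) ^
                  unitBondCount F))) nup
            (constOf l₀ B Em n₁
              (floorOf g (1 / 2 * (B₃ * ε₁) ^ 2 * (6 * (2 * (F.L : ℝ) ^ F.m) ^ 4))
                ((HaarData.haar : Measure (Matrix.specialUnitaryGroup (Fin N) ℂ)).real (suOpBall N τ) ^
                  unitBondCount F)) Nup) K₀ := by
  obtain ⟨γB, hγB, em, ep, hcor⟩ := hB.2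
  refine ⟨γB, hγB, fun γ g hγ => ⟨max (em g) 0, le_max_right _ _, ?_⟩⟩
  intro g₀ htuned κ ι T A K₀ hα τ hτ uK εK B₃ ε₁ n₁ hchi hwil hreg hε hsites nup Nup hnup
  exact lowEnvelope_of_cor3With_minimiser_specialUnitary D hsign hcor hγ htuned κ hobs hbd hα hτ uK hchi hwil hreg hε
    hsites hnup

/-- **… AND INTO (GD)** in `SU(N)` (one run): with the numerator owners' fields the pin yields `GlobalDom` itself, its
denominator fields carrying the explicit `SU(N)` floor. [folklore] -/
theorem globalDom_of_minimiser_specialUnitary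
    (D : FiniteEpsData F (Matrix.specialUnitaryGroup (Fin N) ℂ)) (hsign : B16.SignConventions D.C)
    {γB γ g : ℝ} {em ep : ℝ → ℝ} {g₀ : ℕ → ℝ} (hcor : B16.Cor3With D.C γB em ep) (hγ : γ ≤ γB)
    (htuned : D.Tuned γ g g₀) (κ : ℕ → ℕ)
    {obs : (K : ℕ) → GaugeField (F.P K) 0 (Matrix.specialUnitaryGroup (Fin N) ℂ) → ℝ} {B l₀ : ℝ}
    (hobs : ∀ K, Measurable (obs K)) (hbd : ∀ K U, |obs K U| ≤ B)
    {ι : Type*} {T : ℕ → Finset ι} {A : ℕ → ℝ → ι → ℝ} {K₀ : ℕ}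
    (hα : ∀ K t, |t| ≤ l₀ → K₀ ≤ K →
      ∫ U, Real.exp (t * obs (κ K) U) * D.dens (κ K) (g₀ (κ K)) 0 U
          ∂fieldMeasure (F.P (κ K)) 0 (Matrix.specialUnitaryGroup (Fin N) ℂ) ≤ ∑ τ ∈ T K, A K t τ)
    {τ : ℝ} (hτ : 0 < τ)
    (uK : (K : ℕ) → GaugeField (F.P (κ K)) (κ K) (Matrix.specialUnitaryGroup (Fin N) ℂ) →
      GaugeField (F.P (κ K)) 0 (Matrix.specialUnitaryGroup (Fin N) ℂ))
    {εK : ℕ → ℝ} {B₃ ε₁ n₁ : ℝ}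
    (hchi : ∀ K, K₀ ≤ K → ∀ V, PlaqSmall (εK K * (F.P (κ K)).eta (κ K) ^ 2) (uK K V) →
      (D.C ⟨κ K, F.m, g₀ (κ K)⟩).χ (κ K) ((D.real.cfg (κ K) (g₀ (κ K)) (κ K)).symm V) = 1)
    (hwil : ∀ K, K₀ ≤ K → ∀ V,
      (D.C ⟨κ K, F.m, g₀ (κ K)⟩).wilsonBG (κ K) ((D.real.cfg (κ K) (g₀ (κ K)) (κ K)).symm V) = wilsonAction4 (uK K V))
    (hreg : ∀ K, K₀ ≤ K → ∀ V : GaugeField (F.P (κ K)) (κ K) (Matrix.specialUnitaryGroup (Fin N) ℂ),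
      (∀ b, V b ∈ suOpBall N τ) → PlaqSmall (B₃ * ε₁ * (F.P (κ K)).eta (κ K) ^ 2) (uK K V))
    (hε : ∀ K, K₀ ≤ K → B₃ * ε₁ ≤ εK K)
    (hsites : ∀ K, K₀ ≤ K → ((D.C ⟨κ K, F.m, g₀ (κ K)⟩).numSites (κ K) : ℝ) ≤ n₁)
    {nup : ℕ → ℝ → ℝ} {Nup : ℝ} (hnup : ∀ K t, |t| ≤ l₀ → K₀ ≤ K → 0 ≤ nup K t ∧ nup K t ≤ Nup)
    {Bad : ℕ → ℝ → Finset ι} {Fh : ℕ → ι → ℝ}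
    (bad_subset : ∀ K t, |t| ≤ l₀ → K₀ ≤ K → Bad K t ⊆ T K)
    (up : ∀ K t, |t| ≤ l₀ → K₀ ≤ K → ∀ τ ∈ Bad K t, A K t τ ≤ Fh K τ * nup K t)
    (F_nonneg : ∀ K t, |t| ≤ l₀ → K₀ ≤ K → ∀ τ ∈ Bad K t, 0 ≤ Fh K τ) :
    GlobalDom l₀ T A Bad Fh
      (nlowOf l₀ B (max (em g) 0) n₁
        (floorOf g (1 / 2 * (B₃ * ε₁) ^ 2 * (6 * (2 * (F.L : ℝ) ^ F.m) ^ 4))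
          ((HaarData.haar : Measure (Matrix.specialUnitaryGroup (Fin N) ℂ)).real (suOpBall N τ) ^ unitBondCount F))) nup
      (constOf l₀ B (max (em g) 0) n₁
        (floorOf g (1 / 2 * (B₃ * ε₁) ^ 2 * (6 * (2 * (F.L : ℝ) ^ F.m) ^ 4))
          ((HaarData.haar : Measure (Matrix.specialUnitaryGroup (Fin N) ℂ)).real (suOpBall N τ) ^ unitBondCount F)) Nup)
      K₀ :=
  globalDom_of_lowEnvelope
    (lowEnvelope_of_cor3With_minimiser_specialUnitary D hsign hcor hγ htuned κ hobs hbd hα hτ uK hchi hwil hreg hε hsites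
      hnup) bad_subset up F_nonneg

end SpecialUnitary

section Unitary

variable {N : ℕ} [NeZero N] {F : T4Family}

/-- **THE (γ) FLOOR IN `U(N)`, DICTIONARY IN MINIMISER FORM** — as `lowEnvelope_of_cor3With_minimiser_specialUnitary` with
`G := U(N)` and the ball `unitaryOpBall N τ` of `Literature.Barriers.QuantumFields.UnitaryHaarSmallBall`.
[cite: Balaban1988Convergent, Cor. 3 (2.50) p.264] -/
theorem lowEnvelope_of_cor3With_minimiser_unitary
    (D : FiniteEpsData F (Matrix.unitaryGroup (Fin N) ℂ)) (hsign : B16.SignConventions D.C)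
    {γB γ g : ℝ} {em ep : ℝ → ℝ} {g₀ : ℕ → ℝ} (hcor : B16.Cor3With D.C γB em ep) (hγ : γ ≤ γB)
    (htuned : D.Tuned γ g g₀) (κ : ℕ → ℕ)
    {obs : (K : ℕ) → GaugeField (F.P K) 0 (Matrix.unitaryGroup (Fin N) ℂ) → ℝ} {B l₀ : ℝ}
    (hobs : ∀ K, Measurable (obs K)) (hbd : ∀ K U, |obs K U| ≤ B)
    {ι : Type*} {T : ℕ → Finset ι} {A : ℕ → ℝ → ι → ℝ} {K₀ : ℕ}
    (hα : ∀ K t, |t| ≤ l₀ → K₀ ≤ K →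
      ∫ U, Real.exp (t * obs (κ K) U) * D.dens (κ K) (g₀ (κ K)) 0 U
          ∂fieldMeasure (F.P (κ K)) 0 (Matrix.unitaryGroup (Fin N) ℂ) ≤ ∑ τ ∈ T K, A K t τ)
    {τ : ℝ} (hτ : 0 < τ)
    (uK : (K : ℕ) → GaugeField (F.P (κ K)) (κ K) (Matrix.unitaryGroup (Fin N) ℂ) →
      GaugeField (F.P (κ K)) 0 (Matrix.unitaryGroup (Fin N) ℂ))
    {εK : ℕ → ℝ} {B₃ ε₁ n₁ : ℝ}
    (hchi : ∀ K, K₀ ≤ K → ∀ V, PlaqSmall (εK K * (F.P (κ K)).eta (κ K) ^ 2) (uK K V) →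
      (D.C ⟨κ K, F.m, g₀ (κ K)⟩).χ (κ K) ((D.real.cfg (κ K) (g₀ (κ K)) (κ K)).symm V) = 1)
    (hwil : ∀ K, K₀ ≤ K → ∀ V,
      (D.C ⟨κ K, F.m, g₀ (κ K)⟩).wilsonBG (κ K) ((D.real.cfg (κ K) (g₀ (κ K)) (κ K)).symm V) = wilsonAction4 (uK K V))
    (hreg : ∀ K, K₀ ≤ K → ∀ V : GaugeField (F.P (κ K)) (κ K) (Matrix.unitaryGroup (Fin N) ℂ),
      (∀ b, V b ∈ unitaryOpBall N τ) → PlaqSmall (B₃ * ε₁ * (F.P (κ K)).eta (κ K) ^ 2) (uK K V))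
    (hε : ∀ K, K₀ ≤ K → B₃ * ε₁ ≤ εK K)
    (hsites : ∀ K, K₀ ≤ K → ((D.C ⟨κ K, F.m, g₀ (κ K)⟩).numSites (κ K) : ℝ) ≤ n₁)
    {nup : ℕ → ℝ → ℝ} {Nup : ℝ} (hnup : ∀ K t, |t| ≤ l₀ → K₀ ≤ K → 0 ≤ nup K t ∧ nup K t ≤ Nup) :
    LowEnvelope l₀ T A
      (nlowOf l₀ B (max (em g) 0) n₁
        (floorOf g (1 / 2 * (B₃ * ε₁) ^ 2 * (6 * (2 * (F.L : ℝ) ^ F.m) ^ 4))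
          ((HaarData.haar : Measure (Matrix.unitaryGroup (Fin N) ℂ)).real (unitaryOpBall N τ) ^ unitBondCount F))) nup
      (constOf l₀ B (max (em g) 0) n₁
        (floorOf g (1 / 2 * (B₃ * ε₁) ^ 2 * (6 * (2 * (F.L : ℝ) ^ F.m) ^ 4))
          ((HaarData.haar : Measure (Matrix.unitaryGroup (Fin N) ℂ)).real (unitaryOpBall N τ) ^ unitBondCount F)) Nup)
      K₀ :=
  lowEnvelope_of_cor3With_reading D hsign hcor hγ htuned κ hobs hbd hα (measurableSet_unitaryOpBall τ)
    (haarReal_unitaryOpBall_pos hτ) (Fine := fun K => Plaq (F.P (κ K)) 0) (fun K V p => GaugeField.plaqHol (uK K V) p)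
    (εK := εK) (η := fun K => (F.P (κ K)).eta (κ K))
    (fun K hK V hV => hchi K hK V hV) (fun K hK V => by rw [hwil K hK V, wilsonAction4_eq_sum])
    one_sub_reTr_le_half_dist1_sq_unitary (by norm_num)
    (fun K _ => (card_plaq_fine_mul_eta_pow F (κ K)).le) (fun K hK V hV => hreg K hK V hV) hε hsites hnup

end Unitary

/-! ## §3 The floor is a number -/

section Numbers

variable {N : ℕ} [NeZero N]

/-- **THE `SU(N)` FLOOR IS A CLOSED FORM**: `c₀ = floorOf g a (haar(suOpBall N τ)^{unitBondCount F})
≥ exp[−a/g²]·(suOpBallMass N τ)^{4(2L^m)^4}` — explicit in `(g, N, L, m, τ, a)`. [folklore] -/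
theorem floorOf_suOpBall_ge (F : T4Family) (g a : ℝ) {τ : ℝ} (hτ : 0 < τ) :
    Real.exp (-(1 / g ^ 2 * a)) * suOpBallMass N τ ^ unitBondCount F ≤
      floorOf g a
        ((HaarData.haar : Measure (Matrix.specialUnitaryGroup (Fin N) ℂ)).real (suOpBall N τ) ^ unitBondCount F) := by
  rw [floorOf_eq]
  exact mul_le_mul_of_nonneg_left
    (pow_le_pow_left₀ (suOpBallMass_pos hτ).le (suOpBallMass_le_haarReal hτ) _) (Real.exp_nonneg _)

/-- **THE `U(N)` FLOOR IS A CLOSED FORM**: `c₀ ≥ exp[−a/g²]·((τ/(2π+τ))^{N²})^{4(2L^m)^4}`. [folklore] -/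
theorem floorOf_unitaryOpBall_ge (F : T4Family) (g a : ℝ) {τ : ℝ} (hτ : 0 < τ) :
    Real.exp (-(1 / g ^ 2 * a)) * unitaryOpBallMass N τ ^ unitBondCount F ≤
      floorOf g a
        ((HaarData.haar : Measure (Matrix.unitaryGroup (Fin N) ℂ)).real (unitaryOpBall N τ) ^ unitBondCount F) := by
  rw [floorOf_eq]
  exact mul_le_mul_of_nonneg_left
    (pow_le_pow_left₀ (unitaryOpBallMass_pos hτ).le (unitaryOpBallMass_le_haarReal hτ) _) (Real.exp_nonneg _)

omit [NeZero N] in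
/-- The explicit `SU(N)` floor is POSITIVE (so the socket's `constOf` is finite and `nlowOf` positive with it). [folklore] -/
theorem suFloor_pos (F : T4Family) (g a : ℝ) {τ : ℝ} (hτ : 0 < τ) :
    0 < Real.exp (-(1 / g ^ 2 * a)) * suOpBallMass N τ ^ unitBondCount F :=
  mul_pos (Real.exp_pos _) (pow_pos (suOpBallMass_pos hτ) _)

/-- `suOpBallMass` unfolded (for readers who want the number). [folklore] -/
theorem suOpBallMass_eq (N : ℕ) (τ : ℝ) :
    suOpBallMass N τ = 4 * Real.pi / ((2 * N + 1) * τ) * (τ / (16 * Real.pi + τ)) ^ (N * N) := rfl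

/-- `unitaryOpBallMass` unfolded. [folklore] -/
theorem unitaryOpBallMass_eq (N : ℕ) (τ : ℝ) : unitaryOpBallMass N τ = (τ / (2 * Real.pi + τ)) ^ (N * N) := rfl

end Numbers

/-! ## §4 (v1.1) TWO DATA BINDERS — the GLOBAL minimiser `uK` ((D2), (D3′)) and the LOCALISED minimisers `uLoc` with their
neighbourhood plaquette sets `nbhd` ((D1), (D3″)); item O-R13 of RULING R-GD-2 -/

section TwoFamiliesSpecialUnitary

variable {N : ℕ} [NeZero N] {F : T4Family}

/-- **THE (γ) FLOOR IN `SU(N)`, DICTIONARY IN MINIMISER FORM WITH TWO DATA BINDERS.**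
`T4StabilityFloor.lowEnvelope_of_cor3With_reading₂` with `G := SU(N)`, `B := suOpBall N τ`, `c_G := ½`,
`Fine K := Plaq (F.P (κ K)) 0`, `n₄ := 6(2L^m)^4`, the GLOBAL family `plaq K V p := (uK K V)(∂p)` and the LOCALISED family
`FineLoc K := Σ □ : Box K, nbhd K □`, `plaqLoc K V ⟨□, p⟩ := (uLoc K V □)(∂p)`.  DATA (the instantiating seat's, never
constructed here): `uK K V` = «U_K(V)» ([Balaban1985Variational] p. 279, the global minimiser), `uLoc K V □` = the localised
minimal configuration `U_{K,□}(V)` of [Balaban1988Convergent] (2.16) p. 257 and `nbhd K □` = the plaquettes `p ⊂ □~`.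
Displayed, NOT asserted: (D1) `hchi` — (2.17) p. 257 «χ_k(Ω_k) = Π_{□⊂Ω_k} χ({sup_{p⊂□~}|U_{k,□}(V_k,∂p) − 1| < ε_kη²})»
at `k = K`, `Ω_K = T_η`; (D2) `hwil` — (5)/(0.2) for the global `U_K(V)`; (D3′) `hreg` — Thm 1 (8) for `U_K` on the bond
ball; (D3″) `hregLoc` — (8)-TYPE regularity of the `U_{K,□}` on the bond ball (print sentence to be LOCATED by the
dictionary seat or booked [R], R-GD-2 P-6); `hε` — `B₃ε₁ ≤ ε_K`; and the socket's binders.  SAME floor as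
`lowEnvelope_of_cor3With_minimiser_specialUnitary`. [cite: Balaban1988Convergent, Cor. 3 (2.50) p.264] -/
theorem lowEnvelope_of_cor3With_minimiser₂_specialUnitary
    (D : FiniteEpsData F (Matrix.specialUnitaryGroup (Fin N) ℂ)) (hsign : B16.SignConventions D.C)
    {γB γ g : ℝ} {em ep : ℝ → ℝ} {g₀ : ℕ → ℝ} (hcor : B16.Cor3With D.C γB em ep) (hγ : γ ≤ γB)
    (htuned : D.Tuned γ g g₀) (κ : ℕ → ℕ)
    {obs : (K : ℕ) → GaugeField (F.P K) 0 (Matrix.specialUnitaryGroup (Fin N) ℂ) → ℝ} {B l₀ : ℝ}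
    (hobs : ∀ K, Measurable (obs K)) (hbd : ∀ K U, |obs K U| ≤ B)
    {ι : Type*} {T : ℕ → Finset ι} {A : ℕ → ℝ → ι → ℝ} {K₀ : ℕ}
    (hα : ∀ K t, |t| ≤ l₀ → K₀ ≤ K →
      ∫ U, Real.exp (t * obs (κ K) U) * D.dens (κ K) (g₀ (κ K)) 0 U
          ∂fieldMeasure (F.P (κ K)) 0 (Matrix.specialUnitaryGroup (Fin N) ℂ) ≤ ∑ τ ∈ T K, A K t τ)
    {τ : ℝ} (hτ : 0 < τ)
    (uK : (K : ℕ) → GaugeField (F.P (κ K)) (κ K) (Matrix.specialUnitaryGroup (Fin N) ℂ) → GaugeField (F.P (κ K)) 0 (Matrix.specialUnitaryGroup (Fin N) ℂ))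
    {Box : ℕ → Type*}
    (uLoc : (K : ℕ) → GaugeField (F.P (κ K)) (κ K) (Matrix.specialUnitaryGroup (Fin N) ℂ) → Box K → GaugeField (F.P (κ K)) 0 (Matrix.specialUnitaryGroup (Fin N) ℂ))
    (nbhd : (K : ℕ) → Box K → Set (Plaq (F.P (κ K)) 0))
    {εK : ℕ → ℝ} {B₃ ε₁ n₁ : ℝ}
    (hchi : ∀ K, K₀ ≤ K → ∀ V,
      (∀ c, ∀ p ∈ nbhd K c, dist1 (GaugeField.plaqHol (uLoc K V c) p) < εK K * (F.P (κ K)).eta (κ K) ^ 2) →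
      (D.C ⟨κ K, F.m, g₀ (κ K)⟩).χ (κ K) ((D.real.cfg (κ K) (g₀ (κ K)) (κ K)).symm V) = 1)
    (hwil : ∀ K, K₀ ≤ K → ∀ V,
      (D.C ⟨κ K, F.m, g₀ (κ K)⟩).wilsonBG (κ K) ((D.real.cfg (κ K) (g₀ (κ K)) (κ K)).symm V) = wilsonAction4 (uK K V))
    (hregLoc : ∀ K, K₀ ≤ K → ∀ V : GaugeField (F.P (κ K)) (κ K) (Matrix.specialUnitaryGroup (Fin N) ℂ), (∀ b, V b ∈ suOpBall N τ) →
      ∀ c, ∀ p ∈ nbhd K c, dist1 (GaugeField.plaqHol (uLoc K V c) p) < B₃ * ε₁ * (F.P (κ K)).eta (κ K) ^ 2)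
    (hreg : ∀ K, K₀ ≤ K → ∀ V : GaugeField (F.P (κ K)) (κ K) (Matrix.specialUnitaryGroup (Fin N) ℂ),
      (∀ b, V b ∈ suOpBall N τ) → PlaqSmall (B₃ * ε₁ * (F.P (κ K)).eta (κ K) ^ 2) (uK K V))
    (hε : ∀ K, K₀ ≤ K → B₃ * ε₁ ≤ εK K)
    (hsites : ∀ K, K₀ ≤ K → ((D.C ⟨κ K, F.m, g₀ (κ K)⟩).numSites (κ K) : ℝ) ≤ n₁)
    {nup : ℕ → ℝ → ℝ} {Nup : ℝ} (hnup : ∀ K t, |t| ≤ l₀ → K₀ ≤ K → 0 ≤ nup K t ∧ nup K t ≤ Nup) :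
    LowEnvelope l₀ T A
      (nlowOf l₀ B (max (em g) 0) n₁
        (floorOf g (1 / 2 * (B₃ * ε₁) ^ 2 * (6 * (2 * (F.L : ℝ) ^ F.m) ^ 4))
          ((HaarData.haar : Measure (Matrix.specialUnitaryGroup (Fin N) ℂ)).real (suOpBall N τ) ^ unitBondCount F))) nup
      (constOf l₀ B (max (em g) 0) n₁
        (floorOf g (1 / 2 * (B₃ * ε₁) ^ 2 * (6 * (2 * (F.L : ℝ) ^ F.m) ^ 4))
          ((HaarData.haar : Measure (Matrix.specialUnitaryGroup (Fin N) ℂ)).real (suOpBall N τ) ^ unitBondCount F)) Nup)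
      K₀ :=
  lowEnvelope_of_cor3With_reading₂ D hsign hcor hγ htuned κ hobs hbd hα (measurableSet_suOpBall τ)
    (haarReal_suOpBall_pos hτ) (FineLoc := fun K => (c : Box K) × (nbhd K c))
    (fun K V q => GaugeField.plaqHol (uLoc K V q.1) q.2.1)
    (Fine := fun K => Plaq (F.P (κ K)) 0) (fun K V p => GaugeField.plaqHol (uK K V) p)
    (εK := εK) (η := fun K => (F.P (κ K)).eta (κ K))
    (fun K hK V hV => hchi K hK V fun c p hp => hV ⟨c, ⟨p, hp⟩⟩)
    (fun K hK V => by rw [hwil K hK V, wilsonAction4_eq_sum])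
    one_sub_reTr_le_half_dist1_sq_specialUnitary (by norm_num)
    (fun K _ => (card_plaq_fine_mul_eta_pow F (κ K)).le)
    (fun K hK V hV q => hregLoc K hK V hV q.1 q.2.1 q.2.2)
    (fun K hK V hV => hreg K hK V hV) hε hsites hnup

/-- **… AND INTO (GD)** in `SU(N)` with two data binders (numerator fields from their owners). [folklore] -/
theorem globalDom_of_minimiser₂_specialUnitary
    (D : FiniteEpsData F (Matrix.specialUnitaryGroup (Fin N) ℂ)) (hsign : B16.SignConventions D.C)
    {γB γ g : ℝ} {em ep : ℝ → ℝ} {g₀ : ℕ → ℝ} (hcor : B16.Cor3With D.C γB em ep) (hγ : γ ≤ γB)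
    (htuned : D.Tuned γ g g₀) (κ : ℕ → ℕ)
    {obs : (K : ℕ) → GaugeField (F.P K) 0 (Matrix.specialUnitaryGroup (Fin N) ℂ) → ℝ} {B l₀ : ℝ}
    (hobs : ∀ K, Measurable (obs K)) (hbd : ∀ K U, |obs K U| ≤ B)
    {ι : Type*} {T : ℕ → Finset ι} {A : ℕ → ℝ → ι → ℝ} {K₀ : ℕ}
    (hα : ∀ K t, |t| ≤ l₀ → K₀ ≤ K →
      ∫ U, Real.exp (t * obs (κ K) U) * D.dens (κ K) (g₀ (κ K)) 0 U
          ∂fieldMeasure (F.P (κ K)) 0 (Matrix.specialUnitaryGroup (Fin N) ℂ) ≤ ∑ τ ∈ T K, A K t τ)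
    {τ : ℝ} (hτ : 0 < τ)
    (uK : (K : ℕ) → GaugeField (F.P (κ K)) (κ K) (Matrix.specialUnitaryGroup (Fin N) ℂ) → GaugeField (F.P (κ K)) 0 (Matrix.specialUnitaryGroup (Fin N) ℂ))
    {Box : ℕ → Type*}
    (uLoc : (K : ℕ) → GaugeField (F.P (κ K)) (κ K) (Matrix.specialUnitaryGroup (Fin N) ℂ) → Box K → GaugeField (F.P (κ K)) 0 (Matrix.specialUnitaryGroup (Fin N) ℂ))
    (nbhd : (K : ℕ) → Box K → Set (Plaq (F.P (κ K)) 0))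
    {εK : ℕ → ℝ} {B₃ ε₁ n₁ : ℝ}
    (hchi : ∀ K, K₀ ≤ K → ∀ V,
      (∀ c, ∀ p ∈ nbhd K c, dist1 (GaugeField.plaqHol (uLoc K V c) p) < εK K * (F.P (κ K)).eta (κ K) ^ 2) →
      (D.C ⟨κ K, F.m, g₀ (κ K)⟩).χ (κ K) ((D.real.cfg (κ K) (g₀ (κ K)) (κ K)).symm V) = 1)
    (hwil : ∀ K, K₀ ≤ K → ∀ V,
      (D.C ⟨κ K, F.m, g₀ (κ K)⟩).wilsonBG (κ K) ((D.real.cfg (κ K) (g₀ (κ K)) (κ K)).symm V) = wilsonAction4 (uK K V))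
    (hregLoc : ∀ K, K₀ ≤ K → ∀ V : GaugeField (F.P (κ K)) (κ K) (Matrix.specialUnitaryGroup (Fin N) ℂ), (∀ b, V b ∈ suOpBall N τ) →
      ∀ c, ∀ p ∈ nbhd K c, dist1 (GaugeField.plaqHol (uLoc K V c) p) < B₃ * ε₁ * (F.P (κ K)).eta (κ K) ^ 2)
    (hreg : ∀ K, K₀ ≤ K → ∀ V : GaugeField (F.P (κ K)) (κ K) (Matrix.specialUnitaryGroup (Fin N) ℂ),
      (∀ b, V b ∈ suOpBall N τ) → PlaqSmall (B₃ * ε₁ * (F.P (κ K)).eta (κ K) ^ 2) (uK K V))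
    (hε : ∀ K, K₀ ≤ K → B₃ * ε₁ ≤ εK K)
    (hsites : ∀ K, K₀ ≤ K → ((D.C ⟨κ K, F.m, g₀ (κ K)⟩).numSites (κ K) : ℝ) ≤ n₁)
    {nup : ℕ → ℝ → ℝ} {Nup : ℝ} (hnup : ∀ K t, |t| ≤ l₀ → K₀ ≤ K → 0 ≤ nup K t ∧ nup K t ≤ Nup)
    {Bad : ℕ → ℝ → Finset ι} {Fh : ℕ → ι → ℝ}
    (bad_subset : ∀ K t, |t| ≤ l₀ → K₀ ≤ K → Bad K t ⊆ T K)
    (up : ∀ K t, |t| ≤ l₀ → K₀ ≤ K → ∀ τ ∈ Bad K t, A K t τ ≤ Fh K τ * nup K t)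
    (F_nonneg : ∀ K t, |t| ≤ l₀ → K₀ ≤ K → ∀ τ ∈ Bad K t, 0 ≤ Fh K τ) :
    GlobalDom l₀ T A Bad Fh
      (nlowOf l₀ B (max (em g) 0) n₁
        (floorOf g (1 / 2 * (B₃ * ε₁) ^ 2 * (6 * (2 * (F.L : ℝ) ^ F.m) ^ 4))
          ((HaarData.haar : Measure (Matrix.specialUnitaryGroup (Fin N) ℂ)).real (suOpBall N τ) ^ unitBondCount F))) nup
      (constOf l₀ B (max (em g) 0) n₁
        (floorOf g (1 / 2 * (B₃ * ε₁) ^ 2 * (6 * (2 * (F.L : ℝ) ^ F.m) ^ 4))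
          ((HaarData.haar : Measure (Matrix.specialUnitaryGroup (Fin N) ℂ)).real (suOpBall N τ) ^ unitBondCount F)) Nup)
      K₀ :=
  globalDom_of_lowEnvelope
    (lowEnvelope_of_cor3With_minimiser₂_specialUnitary D hsign hcor hγ htuned κ hobs hbd hα hτ uK uLoc nbhd hchi hwil
      hregLoc hreg hε hsites hnup) bad_subset up F_nonneg

/-- The one-binder theorem of §2 IS the case `Box K := Unit`, `uLoc K V _ := uK K V`, `nbhd K _ := univ` of the two-binder
one (consistency of §2 with §4). [folklore] -/
theorem lowEnvelope_of_cor3With_minimiser₂_specialUnitary_self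
    (D : FiniteEpsData F (Matrix.specialUnitaryGroup (Fin N) ℂ)) (hsign : B16.SignConventions D.C)
    {γB γ g : ℝ} {em ep : ℝ → ℝ} {g₀ : ℕ → ℝ} (hcor : B16.Cor3With D.C γB em ep) (hγ : γ ≤ γB)
    (htuned : D.Tuned γ g g₀) (κ : ℕ → ℕ)
    {obs : (K : ℕ) → GaugeField (F.P K) 0 (Matrix.specialUnitaryGroup (Fin N) ℂ) → ℝ} {B l₀ : ℝ}
    (hobs : ∀ K, Measurable (obs K)) (hbd : ∀ K U, |obs K U| ≤ B)
    {ι : Type*} {T : ℕ → Finset ι} {A : ℕ → ℝ → ι → ℝ} {K₀ : ℕ}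
    (hα : ∀ K t, |t| ≤ l₀ → K₀ ≤ K →
      ∫ U, Real.exp (t * obs (κ K) U) * D.dens (κ K) (g₀ (κ K)) 0 U
          ∂fieldMeasure (F.P (κ K)) 0 (Matrix.specialUnitaryGroup (Fin N) ℂ) ≤ ∑ τ ∈ T K, A K t τ)
    {τ : ℝ} (hτ : 0 < τ)
    (uK : (K : ℕ) → GaugeField (F.P (κ K)) (κ K) (Matrix.specialUnitaryGroup (Fin N) ℂ) →
      GaugeField (F.P (κ K)) 0 (Matrix.specialUnitaryGroup (Fin N) ℂ))
    {εK : ℕ → ℝ} {B₃ ε₁ n₁ : ℝ}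
    (hchi : ∀ K, K₀ ≤ K → ∀ V, PlaqSmall (εK K * (F.P (κ K)).eta (κ K) ^ 2) (uK K V) →
      (D.C ⟨κ K, F.m, g₀ (κ K)⟩).χ (κ K) ((D.real.cfg (κ K) (g₀ (κ K)) (κ K)).symm V) = 1)
    (hwil : ∀ K, K₀ ≤ K → ∀ V,
      (D.C ⟨κ K, F.m, g₀ (κ K)⟩).wilsonBG (κ K) ((D.real.cfg (κ K) (g₀ (κ K)) (κ K)).symm V) = wilsonAction4 (uK K V))
    (hreg : ∀ K, K₀ ≤ K → ∀ V : GaugeField (F.P (κ K)) (κ K) (Matrix.specialUnitaryGroup (Fin N) ℂ),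
      (∀ b, V b ∈ suOpBall N τ) → PlaqSmall (B₃ * ε₁ * (F.P (κ K)).eta (κ K) ^ 2) (uK K V))
    (hε : ∀ K, K₀ ≤ K → B₃ * ε₁ ≤ εK K)
    (hsites : ∀ K, K₀ ≤ K → ((D.C ⟨κ K, F.m, g₀ (κ K)⟩).numSites (κ K) : ℝ) ≤ n₁)
    {nup : ℕ → ℝ → ℝ} {Nup : ℝ} (hnup : ∀ K t, |t| ≤ l₀ → K₀ ≤ K → 0 ≤ nup K t ∧ nup K t ≤ Nup) :
    LowEnvelope l₀ T A
      (nlowOf l₀ B (max (em g) 0) n₁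
        (floorOf g (1 / 2 * (B₃ * ε₁) ^ 2 * (6 * (2 * (F.L : ℝ) ^ F.m) ^ 4))
          ((HaarData.haar : Measure (Matrix.specialUnitaryGroup (Fin N) ℂ)).real (suOpBall N τ) ^ unitBondCount F))) nup
      (constOf l₀ B (max (em g) 0) n₁
        (floorOf g (1 / 2 * (B₃ * ε₁) ^ 2 * (6 * (2 * (F.L : ℝ) ^ F.m) ^ 4))
          ((HaarData.haar : Measure (Matrix.specialUnitaryGroup (Fin N) ℂ)).real (suOpBall N τ) ^ unitBondCount F)) Nup)
      K₀ :=
  lowEnvelope_of_cor3With_minimiser₂_specialUnitary D hsign hcor hγ htuned κ hobs hbd hα hτ uK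
    (Box := fun _ => Unit) (fun K V _ => uK K V) (fun _ _ => Set.univ)
    (fun K hK V hV => hchi K hK V fun p => hV () p (Set.mem_univ p)) hwil
    (fun K hK V hV _ p _ => hreg K hK V hV p) hreg hε hsites hnup

end TwoFamiliesSpecialUnitary

section TwoFamiliesUnitary

variable {N : ℕ} [NeZero N] {F : T4Family}

/-- **THE (γ) FLOOR IN `U(N)` WITH TWO DATA BINDERS** — as `lowEnvelope_of_cor3With_minimiser₂_specialUnitary` with
`G := U(N)`, ball `unitaryOpBall N τ`. [cite: Balaban1988Convergent, Cor. 3 (2.50) p.264] -/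
theorem lowEnvelope_of_cor3With_minimiser₂_unitary
    (D : FiniteEpsData F (Matrix.unitaryGroup (Fin N) ℂ)) (hsign : B16.SignConventions D.C)
    {γB γ g : ℝ} {em ep : ℝ → ℝ} {g₀ : ℕ → ℝ} (hcor : B16.Cor3With D.C γB em ep) (hγ : γ ≤ γB)
    (htuned : D.Tuned γ g g₀) (κ : ℕ → ℕ)
    {obs : (K : ℕ) → GaugeField (F.P K) 0 (Matrix.unitaryGroup (Fin N) ℂ) → ℝ} {B l₀ : ℝ}
    (hobs : ∀ K, Measurable (obs K)) (hbd : ∀ K U, |obs K U| ≤ B)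
    {ι : Type*} {T : ℕ → Finset ι} {A : ℕ → ℝ → ι → ℝ} {K₀ : ℕ}
    (hα : ∀ K t, |t| ≤ l₀ → K₀ ≤ K →
      ∫ U, Real.exp (t * obs (κ K) U) * D.dens (κ K) (g₀ (κ K)) 0 U
          ∂fieldMeasure (F.P (κ K)) 0 (Matrix.unitaryGroup (Fin N) ℂ) ≤ ∑ τ ∈ T K, A K t τ)
    {τ : ℝ} (hτ : 0 < τ)
    (uK : (K : ℕ) → GaugeField (F.P (κ K)) (κ K) (Matrix.unitaryGroup (Fin N) ℂ) → GaugeField (F.P (κ K)) 0 (Matrix.unitaryGroup (Fin N) ℂ))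
    {Box : ℕ → Type*}
    (uLoc : (K : ℕ) → GaugeField (F.P (κ K)) (κ K) (Matrix.unitaryGroup (Fin N) ℂ) → Box K → GaugeField (F.P (κ K)) 0 (Matrix.unitaryGroup (Fin N) ℂ))
    (nbhd : (K : ℕ) → Box K → Set (Plaq (F.P (κ K)) 0))
    {εK : ℕ → ℝ} {B₃ ε₁ n₁ : ℝ}
    (hchi : ∀ K, K₀ ≤ K → ∀ V,
      (∀ c, ∀ p ∈ nbhd K c, dist1 (GaugeField.plaqHol (uLoc K V c) p) < εK K * (F.P (κ K)).eta (κ K) ^ 2) →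
      (D.C ⟨κ K, F.m, g₀ (κ K)⟩).χ (κ K) ((D.real.cfg (κ K) (g₀ (κ K)) (κ K)).symm V) = 1)
    (hwil : ∀ K, K₀ ≤ K → ∀ V,
      (D.C ⟨κ K, F.m, g₀ (κ K)⟩).wilsonBG (κ K) ((D.real.cfg (κ K) (g₀ (κ K)) (κ K)).symm V) = wilsonAction4 (uK K V))
    (hregLoc : ∀ K, K₀ ≤ K → ∀ V : GaugeField (F.P (κ K)) (κ K) (Matrix.unitaryGroup (Fin N) ℂ), (∀ b, V b ∈ unitaryOpBall N τ) →
      ∀ c, ∀ p ∈ nbhd K c, dist1 (GaugeField.plaqHol (uLoc K V c) p) < B₃ * ε₁ * (F.P (κ K)).eta (κ K) ^ 2)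
    (hreg : ∀ K, K₀ ≤ K → ∀ V : GaugeField (F.P (κ K)) (κ K) (Matrix.unitaryGroup (Fin N) ℂ),
      (∀ b, V b ∈ unitaryOpBall N τ) → PlaqSmall (B₃ * ε₁ * (F.P (κ K)).eta (κ K) ^ 2) (uK K V))
    (hε : ∀ K, K₀ ≤ K → B₃ * ε₁ ≤ εK K)
    (hsites : ∀ K, K₀ ≤ K → ((D.C ⟨κ K, F.m, g₀ (κ K)⟩).numSites (κ K) : ℝ) ≤ n₁)
    {nup : ℕ → ℝ → ℝ} {Nup : ℝ} (hnup : ∀ K t, |t| ≤ l₀ → K₀ ≤ K → 0 ≤ nup K t ∧ nup K t ≤ Nup) :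
    LowEnvelope l₀ T A
      (nlowOf l₀ B (max (em g) 0) n₁
        (floorOf g (1 / 2 * (B₃ * ε₁) ^ 2 * (6 * (2 * (F.L : ℝ) ^ F.m) ^ 4))
          ((HaarData.haar : Measure (Matrix.unitaryGroup (Fin N) ℂ)).real (unitaryOpBall N τ) ^ unitBondCount F))) nup
      (constOf l₀ B (max (em g) 0) n₁
        (floorOf g (1 / 2 * (B₃ * ε₁) ^ 2 * (6 * (2 * (F.L : ℝ) ^ F.m) ^ 4))
          ((HaarData.haar : Measure (Matrix.unitaryGroup (Fin N) ℂ)).real (unitaryOpBall N τ) ^ unitBondCount F)) Nup)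
      K₀ :=
  lowEnvelope_of_cor3With_reading₂ D hsign hcor hγ htuned κ hobs hbd hα (measurableSet_unitaryOpBall τ)
    (haarReal_unitaryOpBall_pos hτ) (FineLoc := fun K => (c : Box K) × (nbhd K c))
    (fun K V q => GaugeField.plaqHol (uLoc K V q.1) q.2.1)
    (Fine := fun K => Plaq (F.P (κ K)) 0) (fun K V p => GaugeField.plaqHol (uK K V) p)
    (εK := εK) (η := fun K => (F.P (κ K)).eta (κ K))
    (fun K hK V hV => hchi K hK V fun c p hp => hV ⟨c, ⟨p, hp⟩⟩)
    (fun K hK V => by rw [hwil K hK V, wilsonAction4_eq_sum])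
    one_sub_reTr_le_half_dist1_sq_unitary (by norm_num)
    (fun K _ => (card_plaq_fine_mul_eta_pow F (κ K)).le)
    (fun K hK V hV q => hregLoc K hK V hV q.1 q.2.1 q.2.2)
    (fun K hK V hV => hreg K hK V hV) hε hsites hnup

end TwoFamiliesUnitary

/-! ## §5 (v1.2, APPEND-ONLY) HYPOTHESIS (7) DISPLAYED, AND DISCHARGED ON THE BOND BALL — the (D3′)/(D3″) binders in
the literal “(7) ⟹ (8)” shape of [Balaban1985Variational] Thm 1

In §2/§4 the regularity binders (D3′) `hreg` / (D3″) `hregLoc` take the BOND BALL `∀ b, V b ∈ suOpBall N τ` as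
hypothesis, so the seat discharging them from [Balaban1985Variational] Thm 1 p. 279 («for an arbitrary configuration V
satisfying (7) with ε₁ ≤ a₁ there exists a minimal orbit in the space 𝔘_k({Ω_j}, B₃ε₁) ∩ 𝔅_k(𝔅_k, V). (8)») also owed
the bookkeeping “bond ball ⟹ (7)”.  Here that bookkeeping is the KERNEL's: from the interface axioms `dist1_mul_le`,
`dist1_inv` alone, `|V(b) − 1| ≤ τ` for all bonds gives `|V(∂p) − 1| ≤ 4τ` for every plaquette
(`dist1_plaqHol_le_four_mul`; the tree's general sibling with a reference configuration `U₀` is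
`T4ExpWindowSmallField.plaqSmall_of_bdev_le`, cited by name, not imported), hence (7) p. 278 «|(∂V)(p′) − 1| < ε₁ for
p′∈𝔅_k» for `V` on all of `T₁^{(K)}` as soon as `4τ < ε₁` (`plaqSmall_of_bond_le`, model forms
`plaqSmall_of_mem_suOpBall` / `plaqSmall_of_mem_unitaryOpBall`).  The §4 theorems are then RE-TYPED with
(D3′) `hreg : ∀ K ≥ K₀, ∀ V, PlaqSmall ε₁ V → PlaqSmall (B₃ε₁η_K²) (uK K V)` — literally “(7) ⟹ (8)” of Thm 1 for the
GLOBAL minimiser (with (2) p. 278 at `j = k`; the seat discharging it from Thm 1 needs `ε₁ ≤ a₁`, `a₁ = a₁(d, L)`) —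
and (D3″) `hregLoc : ∀ K ≥ K₀, ∀ V, PlaqSmall ε₁ V → ∀ □, ∀ p ∈ nbhd K □, |U_{K,□}(V)(∂p) − 1| < B₃ε₁η_K²` — (8)-TYPE
regularity of the LOCALISED minimisers GIVEN (7) for `V` (print route, the U5 referee's pointer pv06-g22 XREAD I-3:
Thm 1 (8) at `𝔅 := 𝐁_K(□^{~4})`, `V′ := M˙(Q_K^{s*}V_K)` ([Balaban1988Convergent] (2.13)/(2.16), (1.3)), conditional on
(7) for `V′`; the step “(7) for V ⟹ (7) for V′” is the dictionary seat's located step [R] — this binder is displayed,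
asserted nowhere), plus ONE order binder `h4τ : 4τ < ε₁` between the instantiation's numbers (next to `hε : B₃ε₁ ≤ ε_K`).
SAME floor, SAME conclusions as §4; each theorem is the §4 one composed BY NAME with `plaqSmall_of_mem_suOpBall` /
`plaqSmall_of_mem_unitaryOpBall`.  §§1–4 are byte-identical to v1.1 (p191066). -/

section Seven

variable {P : Params} {j : ℕ} {G : Type*} [GaugeGroup G]

/-- **BOND-SMALL ⟹ PLAQUETTE-SMALL, absolute form.**  If every bond variable satisfies `|V(b) − 1| ≤ τ` then every
plaquette variable satisfies `|V(∂p) − 1| ≤ 4τ`: the plaquette word has four letters, two of them inverted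
(`GaugeField.plaqHol`), and `dist1` is subadditive (`dist1_mul_le`) and inversion invariant (`dist1_inv`).  The case
`U₀ = 1` of the tree's `T4ExpWindowSmallField.plaqSmall_of_bdev_le` (cited by name; self-contained here so that the U5c
floor does not import the `SU(2)`-chart cone). [folklore] -/
theorem dist1_plaqHol_le_four_mul {V : GaugeField P j G} {τ : ℝ} (hb : ∀ b, dist1 (V b) ≤ τ) (p : Plaq P j) :
    dist1 (GaugeField.plaqHol V p) ≤ 4 * τ := by
  unfold GaugeField.plaqHol
  have h₁ := GaugeGroup.dist1_mul_le (V ⟨p.src, p.μ⟩ * V ⟨p.src.shift p.μ, p.ν⟩ * (V ⟨p.src.shift p.ν, p.μ⟩)⁻¹)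
    (V ⟨p.src, p.ν⟩)⁻¹
  have h₂ := GaugeGroup.dist1_mul_le (V ⟨p.src, p.μ⟩ * V ⟨p.src.shift p.μ, p.ν⟩) (V ⟨p.src.shift p.ν, p.μ⟩)⁻¹
  have h₃ := GaugeGroup.dist1_mul_le (V ⟨p.src, p.μ⟩) (V ⟨p.src.shift p.μ, p.ν⟩)
  rw [GaugeGroup.dist1_inv] at h₁ h₂
  linarith [hb ⟨p.src, p.μ⟩, hb ⟨p.src.shift p.μ, p.ν⟩, hb ⟨p.src.shift p.ν, p.μ⟩, hb ⟨p.src, p.ν⟩]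

/-- **BOND BALL ⟹ (7).**  `|V(b) − 1| ≤ τ` for all bonds and `4τ < ε₁` give `PlaqSmall ε₁ V`, i.e. [Balaban1985Variational]
(7) p. 278 «|(∂V)(p′) − 1| < ε₁ for p′∈𝔅_k» for `V` on every plaquette of the lattice. [folklore] -/
theorem plaqSmall_of_bond_le {V : GaugeField P j G} {τ ε₁ : ℝ} (hb : ∀ b, dist1 (V b) ≤ τ) (h4τ : 4 * τ < ε₁) :
    PlaqSmall ε₁ V := fun p => (dist1_plaqHol_le_four_mul hb p).trans_lt h4τ

end Seven

section SevenModel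

variable {N : ℕ} [NeZero N] {P : Params} {j : ℕ}

/-- (7) on the `SU(N)` bond ball: `(∀ b, V b ∈ suOpBall N τ) → 4τ < ε₁ → PlaqSmall ε₁ V` (the ball IS `{dist1 ≤ τ}`,
`mem_suOpBall_iff_dist1`). [folklore] -/
theorem plaqSmall_of_mem_suOpBall {V : GaugeField P j (Matrix.specialUnitaryGroup (Fin N) ℂ)} {τ ε₁ : ℝ}
    (hV : ∀ b, V b ∈ suOpBall N τ) (h4τ : 4 * τ < ε₁) : PlaqSmall ε₁ V :=
  plaqSmall_of_bond_le (fun b => mem_suOpBall_iff_dist1.1 (hV b)) h4τ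

/-- (7) on the `U(N)` bond ball: `(∀ b, V b ∈ unitaryOpBall N τ) → 4τ < ε₁ → PlaqSmall ε₁ V`. [folklore] -/
theorem plaqSmall_of_mem_unitaryOpBall {V : GaugeField P j (Matrix.unitaryGroup (Fin N) ℂ)} {τ ε₁ : ℝ}
    (hV : ∀ b, V b ∈ unitaryOpBall N τ) (h4τ : 4 * τ < ε₁) : PlaqSmall ε₁ V :=
  plaqSmall_of_bond_le (fun b => mem_unitaryOpBall_iff_dist1.1 (hV b)) h4τ

end SevenModel

section Thm1SpecialUnitary

variable {N : ℕ} [NeZero N] {F : T4Family}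

/-- **THE (γ) FLOOR IN `SU(N)` WITH TWO DATA BINDERS, (D3′)/(D3″) IN THEOREM-1 FORM.**
`lowEnvelope_of_cor3With_minimiser₂_specialUnitary` with its regularity binders RE-TYPED: (D3′) `hreg` — for every `V`
with (7) p. 278 «|(∂V)(p′) − 1| < ε₁ for p′∈𝔅_k» on all of `T₁^{(K)}` (`PlaqSmall ε₁ V`), the GLOBAL minimiser `U_K(V)`
lies in (8)'s space «𝔘_k({Ω_j}, B₃ε₁)» read with (2) p. 278 at `j = k` (`PlaqSmall (B₃ε₁η_K²) (uK K V)`) — the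
“(7) ⟹ (8)” shape of [Balaban1985Variational] Thm 1 p. 279 («There exist positive constants a₀, a₁, B₃, B₄(β₀), M(ε₁),
B₃a₁ ≤ a₀, such that for an arbitrary configuration V satisfying (7) with ε₁ ≤ a₁ there exists a minimal orbit in the
space 𝔘_k({Ω_j}, B₃ε₁) ∩ 𝔅_k(𝔅_k, V). (8)», «The constants a₀, a₁, B₃, depend on d and L only»; the seat discharging the
binder from it takes `ε₁ ≤ a₁`); (D3″) `hregLoc` — GIVEN (7) for `V`, (8)-TYPE regularity `< B₃ε₁η_K²` of the
LOCALISED minimisers `U_{K,□}(V)` ([Balaban1988Convergent] (2.16) p. 257) on `nbhd K □` (print route = Thm 1 (8) at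
`𝔅 := 𝐁_K(□^{~4})`, `V′ := M˙(Q_K^{s*}V_K)`, (2.13)/(2.16), (1.3), conditional on (7) for `V′` — U5 referee's pointer;
“(7) for V ⟹ (7) for V′” is the dictionary seat's located step [R]); `h4τ : 4τ < ε₁`.  DATA `uK`, `uLoc`, `nbhd`, the
dictionary (D1) `hchi` / (D2) `hwil`, the order `hε` and the socket's binders exactly as in §4; displayed, NOT asserted.
The bond ball ⟹ (7) step is `plaqSmall_of_mem_suOpBall`.  SAME floor
`c₀ = floorOf g (½(B₃ε₁)²·6(2L^m)^4) (haar(suOpBall N τ)^{unitBondCount F})`. [cite: Balaban1988Convergent, Cor. 3 (2.50) p.264] -/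
theorem lowEnvelope_of_cor3With_thm1_specialUnitary
    (D : FiniteEpsData F (Matrix.specialUnitaryGroup (Fin N) ℂ)) (hsign : B16.SignConventions D.C)
    {γB γ g : ℝ} {em ep : ℝ → ℝ} {g₀ : ℕ → ℝ} (hcor : B16.Cor3With D.C γB em ep) (hγ : γ ≤ γB)
    (htuned : D.Tuned γ g g₀) (κ : ℕ → ℕ)
    {obs : (K : ℕ) → GaugeField (F.P K) 0 (Matrix.specialUnitaryGroup (Fin N) ℂ) → ℝ} {B l₀ : ℝ}
    (hobs : ∀ K, Measurable (obs K)) (hbd : ∀ K U, |obs K U| ≤ B)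
    {ι : Type*} {T : ℕ → Finset ι} {A : ℕ → ℝ → ι → ℝ} {K₀ : ℕ}
    (hα : ∀ K t, |t| ≤ l₀ → K₀ ≤ K →
      ∫ U, Real.exp (t * obs (κ K) U) * D.dens (κ K) (g₀ (κ K)) 0 U
          ∂fieldMeasure (F.P (κ K)) 0 (Matrix.specialUnitaryGroup (Fin N) ℂ) ≤ ∑ τ ∈ T K, A K t τ)
    {τ : ℝ} (hτ : 0 < τ)
    (uK : (K : ℕ) → GaugeField (F.P (κ K)) (κ K) (Matrix.specialUnitaryGroup (Fin N) ℂ) → GaugeField (F.P (κ K)) 0 (Matrix.specialUnitaryGroup (Fin N) ℂ))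
    {Box : ℕ → Type*}
    (uLoc : (K : ℕ) → GaugeField (F.P (κ K)) (κ K) (Matrix.specialUnitaryGroup (Fin N) ℂ) → Box K → GaugeField (F.P (κ K)) 0 (Matrix.specialUnitaryGroup (Fin N) ℂ))
    (nbhd : (K : ℕ) → Box K → Set (Plaq (F.P (κ K)) 0))
    {εK : ℕ → ℝ} {B₃ ε₁ n₁ : ℝ}
    (hchi : ∀ K, K₀ ≤ K → ∀ V,
      (∀ c, ∀ p ∈ nbhd K c, dist1 (GaugeField.plaqHol (uLoc K V c) p) < εK K * (F.P (κ K)).eta (κ K) ^ 2) →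
      (D.C ⟨κ K, F.m, g₀ (κ K)⟩).χ (κ K) ((D.real.cfg (κ K) (g₀ (κ K)) (κ K)).symm V) = 1)
    (hwil : ∀ K, K₀ ≤ K → ∀ V,
      (D.C ⟨κ K, F.m, g₀ (κ K)⟩).wilsonBG (κ K) ((D.real.cfg (κ K) (g₀ (κ K)) (κ K)).symm V) = wilsonAction4 (uK K V))
    (hregLoc : ∀ K, K₀ ≤ K → ∀ V : GaugeField (F.P (κ K)) (κ K) (Matrix.specialUnitaryGroup (Fin N) ℂ), PlaqSmall ε₁ V →
      ∀ c, ∀ p ∈ nbhd K c, dist1 (GaugeField.plaqHol (uLoc K V c) p) < B₃ * ε₁ * (F.P (κ K)).eta (κ K) ^ 2)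
    (hreg : ∀ K, K₀ ≤ K → ∀ V : GaugeField (F.P (κ K)) (κ K) (Matrix.specialUnitaryGroup (Fin N) ℂ),
      PlaqSmall ε₁ V → PlaqSmall (B₃ * ε₁ * (F.P (κ K)).eta (κ K) ^ 2) (uK K V))
    (h4τ : 4 * τ < ε₁) (hε : ∀ K, K₀ ≤ K → B₃ * ε₁ ≤ εK K)
    (hsites : ∀ K, K₀ ≤ K → ((D.C ⟨κ K, F.m, g₀ (κ K)⟩).numSites (κ K) : ℝ) ≤ n₁)
    {nup : ℕ → ℝ → ℝ} {Nup : ℝ} (hnup : ∀ K t, |t| ≤ l₀ → K₀ ≤ K → 0 ≤ nup K t ∧ nup K t ≤ Nup) :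
    LowEnvelope l₀ T A
      (nlowOf l₀ B (max (em g) 0) n₁
        (floorOf g (1 / 2 * (B₃ * ε₁) ^ 2 * (6 * (2 * (F.L : ℝ) ^ F.m) ^ 4))
          ((HaarData.haar : Measure (Matrix.specialUnitaryGroup (Fin N) ℂ)).real (suOpBall N τ) ^ unitBondCount F))) nup
      (constOf l₀ B (max (em g) 0) n₁
        (floorOf g (1 / 2 * (B₃ * ε₁) ^ 2 * (6 * (2 * (F.L : ℝ) ^ F.m) ^ 4))
          ((HaarData.haar : Measure (Matrix.specialUnitaryGroup (Fin N) ℂ)).real (suOpBall N τ) ^ unitBondCount F)) Nup)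
      K₀ :=
  lowEnvelope_of_cor3With_minimiser₂_specialUnitary D hsign hcor hγ htuned κ hobs hbd hα hτ uK uLoc nbhd hchi hwil
    (fun K hK V hV => hregLoc K hK V (plaqSmall_of_mem_suOpBall hV h4τ))
    (fun K hK V hV => hreg K hK V (plaqSmall_of_mem_suOpBall hV h4τ)) hε hsites hnup

/-- **… AND INTO (GD)** in `SU(N)`, (D3′)/(D3″) in Theorem-1 form (numerator fields from their owners). [folklore] -/
theorem globalDom_of_thm1_specialUnitary
    (D : FiniteEpsData F (Matrix.specialUnitaryGroup (Fin N) ℂ)) (hsign : B16.SignConventions D.C)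
    {γB γ g : ℝ} {em ep : ℝ → ℝ} {g₀ : ℕ → ℝ} (hcor : B16.Cor3With D.C γB em ep) (hγ : γ ≤ γB)
    (htuned : D.Tuned γ g g₀) (κ : ℕ → ℕ)
    {obs : (K : ℕ) → GaugeField (F.P K) 0 (Matrix.specialUnitaryGroup (Fin N) ℂ) → ℝ} {B l₀ : ℝ}
    (hobs : ∀ K, Measurable (obs K)) (hbd : ∀ K U, |obs K U| ≤ B)
    {ι : Type*} {T : ℕ → Finset ι} {A : ℕ → ℝ → ι → ℝ} {K₀ : ℕ}
    (hα : ∀ K t, |t| ≤ l₀ → K₀ ≤ K →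
      ∫ U, Real.exp (t * obs (κ K) U) * D.dens (κ K) (g₀ (κ K)) 0 U
          ∂fieldMeasure (F.P (κ K)) 0 (Matrix.specialUnitaryGroup (Fin N) ℂ) ≤ ∑ τ ∈ T K, A K t τ)
    {τ : ℝ} (hτ : 0 < τ)
    (uK : (K : ℕ) → GaugeField (F.P (κ K)) (κ K) (Matrix.specialUnitaryGroup (Fin N) ℂ) → GaugeField (F.P (κ K)) 0 (Matrix.specialUnitaryGroup (Fin N) ℂ))
    {Box : ℕ → Type*}
    (uLoc : (K : ℕ) → GaugeField (F.P (κ K)) (κ K) (Matrix.specialUnitaryGroup (Fin N) ℂ) → Box K → GaugeField (F.P (κ K)) 0 (Matrix.specialUnitaryGroup (Fin N) ℂ))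
    (nbhd : (K : ℕ) → Box K → Set (Plaq (F.P (κ K)) 0))
    {εK : ℕ → ℝ} {B₃ ε₁ n₁ : ℝ}
    (hchi : ∀ K, K₀ ≤ K → ∀ V,
      (∀ c, ∀ p ∈ nbhd K c, dist1 (GaugeField.plaqHol (uLoc K V c) p) < εK K * (F.P (κ K)).eta (κ K) ^ 2) →
      (D.C ⟨κ K, F.m, g₀ (κ K)⟩).χ (κ K) ((D.real.cfg (κ K) (g₀ (κ K)) (κ K)).symm V) = 1)
    (hwil : ∀ K, K₀ ≤ K → ∀ V,
      (D.C ⟨κ K, F.m, g₀ (κ K)⟩).wilsonBG (κ K) ((D.real.cfg (κ K) (g₀ (κ K)) (κ K)).symm V) = wilsonAction4 (uK K V))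
    (hregLoc : ∀ K, K₀ ≤ K → ∀ V : GaugeField (F.P (κ K)) (κ K) (Matrix.specialUnitaryGroup (Fin N) ℂ), PlaqSmall ε₁ V →
      ∀ c, ∀ p ∈ nbhd K c, dist1 (GaugeField.plaqHol (uLoc K V c) p) < B₃ * ε₁ * (F.P (κ K)).eta (κ K) ^ 2)
    (hreg : ∀ K, K₀ ≤ K → ∀ V : GaugeField (F.P (κ K)) (κ K) (Matrix.specialUnitaryGroup (Fin N) ℂ),
      PlaqSmall ε₁ V → PlaqSmall (B₃ * ε₁ * (F.P (κ K)).eta (κ K) ^ 2) (uK K V))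
    (h4τ : 4 * τ < ε₁) (hε : ∀ K, K₀ ≤ K → B₃ * ε₁ ≤ εK K)
    (hsites : ∀ K, K₀ ≤ K → ((D.C ⟨κ K, F.m, g₀ (κ K)⟩).numSites (κ K) : ℝ) ≤ n₁)
    {nup : ℕ → ℝ → ℝ} {Nup : ℝ} (hnup : ∀ K t, |t| ≤ l₀ → K₀ ≤ K → 0 ≤ nup K t ∧ nup K t ≤ Nup)
    {Bad : ℕ → ℝ → Finset ι} {Fh : ℕ → ι → ℝ}
    (bad_subset : ∀ K t, |t| ≤ l₀ → K₀ ≤ K → Bad K t ⊆ T K)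
    (up : ∀ K t, |t| ≤ l₀ → K₀ ≤ K → ∀ τ ∈ Bad K t, A K t τ ≤ Fh K τ * nup K t)
    (F_nonneg : ∀ K t, |t| ≤ l₀ → K₀ ≤ K → ∀ τ ∈ Bad K t, 0 ≤ Fh K τ) :
    GlobalDom l₀ T A Bad Fh
      (nlowOf l₀ B (max (em g) 0) n₁
        (floorOf g (1 / 2 * (B₃ * ε₁) ^ 2 * (6 * (2 * (F.L : ℝ) ^ F.m) ^ 4))
          ((HaarData.haar : Measure (Matrix.specialUnitaryGroup (Fin N) ℂ)).real (suOpBall N τ) ^ unitBondCount F))) nup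
      (constOf l₀ B (max (em g) 0) n₁
        (floorOf g (1 / 2 * (B₃ * ε₁) ^ 2 * (6 * (2 * (F.L : ℝ) ^ F.m) ^ 4))
          ((HaarData.haar : Measure (Matrix.specialUnitaryGroup (Fin N) ℂ)).real (suOpBall N τ) ^ unitBondCount F)) Nup)
      K₀ :=
  globalDom_of_lowEnvelope
    (lowEnvelope_of_cor3With_thm1_specialUnitary D hsign hcor hγ htuned κ hobs hbd hα hτ uK uLoc nbhd hchi hwil hregLoc
      hreg h4τ hε hsites hnup) bad_subset up F_nonneg

/-- CONSISTENCY §4 ⊂ §5: the bond-ball binders of `lowEnvelope_of_cor3With_minimiser₂_specialUnitary` FOLLOW from the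
Theorem-1-form binders and `4τ < ε₁` (so a seat holding §5's binders also holds §4's). [folklore] -/
theorem hreg_bondBall_of_thm1 {κ : ℕ → ℕ} {K₀ : ℕ} {τ B₃ ε₁ : ℝ}
    {uK : (K : ℕ) → GaugeField (F.P (κ K)) (κ K) (Matrix.specialUnitaryGroup (Fin N) ℂ) →
      GaugeField (F.P (κ K)) 0 (Matrix.specialUnitaryGroup (Fin N) ℂ)}
    (hreg : ∀ K, K₀ ≤ K → ∀ V : GaugeField (F.P (κ K)) (κ K) (Matrix.specialUnitaryGroup (Fin N) ℂ),
      PlaqSmall ε₁ V → PlaqSmall (B₃ * ε₁ * (F.P (κ K)).eta (κ K) ^ 2) (uK K V))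
    (h4τ : 4 * τ < ε₁) :
    ∀ K, K₀ ≤ K → ∀ V : GaugeField (F.P (κ K)) (κ K) (Matrix.specialUnitaryGroup (Fin N) ℂ),
      (∀ b, V b ∈ suOpBall N τ) → PlaqSmall (B₃ * ε₁ * (F.P (κ K)).eta (κ K) ^ 2) (uK K V) :=
  fun K hK V hV => hreg K hK V (plaqSmall_of_mem_suOpBall hV h4τ)

end Thm1SpecialUnitary

section Thm1Unitary

variable {N : ℕ} [NeZero N] {F : T4Family}

/-- **THE (γ) FLOOR IN `U(N)` WITH TWO DATA BINDERS, (D3′)/(D3″) IN THEOREM-1 FORM** — as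
`lowEnvelope_of_cor3With_thm1_specialUnitary` with `G := U(N)`, ball `unitaryOpBall N τ`.
[cite: Balaban1988Convergent, Cor. 3 (2.50) p.264] -/
theorem lowEnvelope_of_cor3With_thm1_unitary
    (D : FiniteEpsData F (Matrix.unitaryGroup (Fin N) ℂ)) (hsign : B16.SignConventions D.C)
    {γB γ g : ℝ} {em ep : ℝ → ℝ} {g₀ : ℕ → ℝ} (hcor : B16.Cor3With D.C γB em ep) (hγ : γ ≤ γB)
    (htuned : D.Tuned γ g g₀) (κ : ℕ → ℕ)
    {obs : (K : ℕ) → GaugeField (F.P K) 0 (Matrix.unitaryGroup (Fin N) ℂ) → ℝ} {B l₀ : ℝ}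
    (hobs : ∀ K, Measurable (obs K)) (hbd : ∀ K U, |obs K U| ≤ B)
    {ι : Type*} {T : ℕ → Finset ι} {A : ℕ → ℝ → ι → ℝ} {K₀ : ℕ}
    (hα : ∀ K t, |t| ≤ l₀ → K₀ ≤ K →
      ∫ U, Real.exp (t * obs (κ K) U) * D.dens (κ K) (g₀ (κ K)) 0 U
          ∂fieldMeasure (F.P (κ K)) 0 (Matrix.unitaryGroup (Fin N) ℂ) ≤ ∑ τ ∈ T K, A K t τ)
    {τ : ℝ} (hτ : 0 < τ)
    (uK : (K : ℕ) → GaugeField (F.P (κ K)) (κ K) (Matrix.unitaryGroup (Fin N) ℂ) → GaugeField (F.P (κ K)) 0 (Matrix.unitaryGroup (Fin N) ℂ))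
    {Box : ℕ → Type*}
    (uLoc : (K : ℕ) → GaugeField (F.P (κ K)) (κ K) (Matrix.unitaryGroup (Fin N) ℂ) → Box K → GaugeField (F.P (κ K)) 0 (Matrix.unitaryGroup (Fin N) ℂ))
    (nbhd : (K : ℕ) → Box K → Set (Plaq (F.P (κ K)) 0))
    {εK : ℕ → ℝ} {B₃ ε₁ n₁ : ℝ}
    (hchi : ∀ K, K₀ ≤ K → ∀ V,
      (∀ c, ∀ p ∈ nbhd K c, dist1 (GaugeField.plaqHol (uLoc K V c) p) < εK K * (F.P (κ K)).eta (κ K) ^ 2) →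
      (D.C ⟨κ K, F.m, g₀ (κ K)⟩).χ (κ K) ((D.real.cfg (κ K) (g₀ (κ K)) (κ K)).symm V) = 1)
    (hwil : ∀ K, K₀ ≤ K → ∀ V,
      (D.C ⟨κ K, F.m, g₀ (κ K)⟩).wilsonBG (κ K) ((D.real.cfg (κ K) (g₀ (κ K)) (κ K)).symm V) = wilsonAction4 (uK K V))
    (hregLoc : ∀ K, K₀ ≤ K → ∀ V : GaugeField (F.P (κ K)) (κ K) (Matrix.unitaryGroup (Fin N) ℂ), PlaqSmall ε₁ V →
      ∀ c, ∀ p ∈ nbhd K c, dist1 (GaugeField.plaqHol (uLoc K V c) p) < B₃ * ε₁ * (F.P (κ K)).eta (κ K) ^ 2)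
    (hreg : ∀ K, K₀ ≤ K → ∀ V : GaugeField (F.P (κ K)) (κ K) (Matrix.unitaryGroup (Fin N) ℂ),
      PlaqSmall ε₁ V → PlaqSmall (B₃ * ε₁ * (F.P (κ K)).eta (κ K) ^ 2) (uK K V))
    (h4τ : 4 * τ < ε₁) (hε : ∀ K, K₀ ≤ K → B₃ * ε₁ ≤ εK K)
    (hsites : ∀ K, K₀ ≤ K → ((D.C ⟨κ K, F.m, g₀ (κ K)⟩).numSites (κ K) : ℝ) ≤ n₁)
    {nup : ℕ → ℝ → ℝ} {Nup : ℝ} (hnup : ∀ K t, |t| ≤ l₀ → K₀ ≤ K → 0 ≤ nup K t ∧ nup K t ≤ Nup) :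
    LowEnvelope l₀ T A
      (nlowOf l₀ B (max (em g) 0) n₁
        (floorOf g (1 / 2 * (B₃ * ε₁) ^ 2 * (6 * (2 * (F.L : ℝ) ^ F.m) ^ 4))
          ((HaarData.haar : Measure (Matrix.unitaryGroup (Fin N) ℂ)).real (unitaryOpBall N τ) ^ unitBondCount F))) nup
      (constOf l₀ B (max (em g) 0) n₁
        (floorOf g (1 / 2 * (B₃ * ε₁) ^ 2 * (6 * (2 * (F.L : ℝ) ^ F.m) ^ 4))
          ((HaarData.haar : Measure (Matrix.unitaryGroup (Fin N) ℂ)).real (unitaryOpBall N τ) ^ unitBondCount F)) Nup)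
      K₀ :=
  lowEnvelope_of_cor3With_minimiser₂_unitary D hsign hcor hγ htuned κ hobs hbd hα hτ uK uLoc nbhd hchi hwil
    (fun K hK V hV => hregLoc K hK V (plaqSmall_of_mem_unitaryOpBall hV h4τ))
    (fun K hK V hV => hreg K hK V (plaqSmall_of_mem_unitaryOpBall hV h4τ)) hε hsites hnup

end Thm1Unitary

end Literature.MathematicalPhysics.QuantumFieldTheory.Balaban1983to89.T4StabilityFloorUnitary
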